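import Literature.AnabelianGeometry.SemiGraphs.TemperedReconstructionR0CompatProofs
import Literature.AnabelianGeometry.SemiGraphs.TemperedReconstructionReductionsProofsAt
import HarnessLib

/-!
# [SemiAnbd] Cor. 3.9, step (a) under the compatible reading of Def. 3.8, AT ONE PAIR OF GRAPHS
# (φ2 twin of `TemperedReconstructionR0CompatProofs`, proof-only)

Mochizuki, *Semi-graphs of anabelioids*, Publ. RIMS **42** (2006) [MochizukiSemiAnbd2006], Cor. 3.9,
proof, PRIMS p. 267 (kurims p. 42): "any locally open morphism of semi-graphs of anabelioids `G → H`
determines a morphism of temperoids `B^temp(G) → B^temp(H)` … whose quasi-geometricity follows by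
'substituting' the equivalences of Theorem 3.7, (iv), into Definition 3.8"
[cite: MochizukiSemiAnbd2006, Cor 3.9 p.42].

PROOF-ONLY companion (cell abc-iut, layer L3, L3-lead rulings α4-3 (iii) / α6-1 «φ2-CONSUMERS», block
B5, seat abc-iut-w4-d083 = author of the original) of `TemperedReconstructionR0CompatProofs.lean`: the
two declarations there that consume the ∀-countable named facts Thm 3.7 (iii) `CompactInVerticial` /
(iv) `MaximalCompactIffVerticial` — `compat_of_compatV` and `isCompatiblyQuasiGeometric_of_compat` —
re-proved VERBATIM with abc-iut-w4-d075's per-graph predicates (`TemperedCompactInVerticialAt.lean`)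
at the graphs where the original instantiates them: Thm 3.7 (iii) at the SOURCE `𝒢` only
(`(h37iii : CompactInVerticialAt 𝒢)`), Thm 3.7 (iv) at `𝒢` and at `ℋ`
(`(h37iv𝒢 : MaximalCompactIffVerticialAt 𝒢) (h37ivℋ : MaximalCompactIffVerticialAt ℋ)`).  Port
rule: `h37iii 𝒢 h𝒢37 ↦ h37iii h𝒢37`, `h37iv X hX ↦ h37ivX hX`, decl suffix `At`; the literal Def. 3.8
half is abc-iut-L3-d1's per-pair `InducedIsQuasiGeometric_of_at` (block B0a,
`TemperedReconstructionReductionsProofsAt.lean`), consumed by name; the (iii)/(iv)-free lemmas of the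
original (`brHomAt_injective`, `ne_bot_of_isOpen_ge`) are reused via the import; original untouched.
Nothing here asserts Thm 3.7 (iii) for a countable `𝔾`; nothing here takes a side on [IUTchIII]
Cor. 3.12; typed ≠ discharged.
-/

open CategoryTheory Topology

namespace Literature.AnabelianGeometry.SemiGraphs

namespace ProfiniteSemiGraph

universe u

variable {𝒢 ℋ : ProfiniteSemiGraph.{u}}

/-- **Cor. 3.9 (a), the compatibility clause, AT the pair `(𝒢, ℋ)`** (φ2 twin of `compat_of_compatV`;
[SemiAnbd] p. 267, under the compatible reading of Def. 3.8): for `φ` compatible with a locally open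
morphism `F : G → H` of semi-graphs of anabelioids on verticial homomorphisms, two distinct maximal compact
subgroups of `π₁^temp(G)` with nontrivial intersection are carried INTO two distinct maximal compact
subgroups of `π₁^temp(H)` — from Thm 3.7 (i), (ii), Thm 3.7 (iii) at `𝒢` and Thm 3.7 (iv) at `𝒢` and
at `ℋ`. [cite: MochizukiSemiAnbd2006, Cor 3.9 p.42] -/
theorem compat_of_compatVAt (h37i : VerticialInjective.{u}) (h37ii : VerticialDistinct.{u})
    (h37iii : CompactInVerticialAt 𝒢) (h37iv𝒢 : MaximalCompactIffVerticialAt 𝒢)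
    (h37ivℋ : MaximalCompactIffVerticialAt ℋ)
    (h𝒢 : Cor39Hypotheses 𝒢) (hℋ : Cor39Hypotheses ℋ) (c𝒢 : TemperedPiChart 𝒢)
    (cℋ : TemperedPiChart ℋ) (F : Hom 𝒢 ℋ) (φ : c𝒢.G →ₜ* cℋ.G) (hF : F.IsLocallyOpen)
    (hV : F.CompatV c𝒢 cℋ φ) :
    ∀ K₁ H₁ : Subgroup c𝒢.G, IsMaximalCompactSubgroup K₁ → IsMaximalCompactSubgroup H₁ → K₁ ≠ H₁ →
      K₁ ⊓ H₁ ≠ ⊥ → ∃ K₂ H₂ : Subgroup cℋ.G, IsMaximalCompactSubgroup K₂ ∧ IsMaximalCompactSubgroup H₂ ∧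
        K₂ ≠ H₂ ∧ K₁.map φ.toMonoidHom ≤ K₂ ∧ H₁.map φ.toMonoidHom ≤ H₂ := by
  classical
  intro K₁ H₁ hK₁ hH₁ hne hnt
  haveI := TemperedPiChart.t2Space c𝒢
  haveI := TemperedPiChart.t2Space cℋ
  have h𝒢37 := h𝒢.thm37Hypotheses
  have hℋ37 := hℋ.thm37Hypotheses
  obtain ⟨hmax𝒢, hint𝒢⟩ := h37iv𝒢 h𝒢37 c𝒢
  obtain ⟨hmaxℋ, -⟩ := h37ivℋ hℋ37 cℋ
  choose ψ hψ using exists_isVerticialHom_of_thm37i h37i h𝒢37 c𝒢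
  choose Ψ hΨ using exists_isVerticialHom_of_thm37i h37i hℋ37 cℋ
  -- `L := K₁ ⊓ H₁` is an edge-like subgroup of a closed edge `e`
  obtain ⟨e, he, hL⟩ := (hint𝒢 (K₁ ⊓ H₁) hnt).mp ⟨K₁, H₁, hK₁, hH₁, hne, rfl⟩
  obtain ⟨b₁, b₂, v₁, v₂, hb12, q₁, q₂, hv₁, hv₂⟩ := SemiGraph.exists_branches_of_isClosedEdge he
  -- `L = gᵢ ψ_{vᵢ}(Π_{bᵢ}) gᵢ⁻¹`
  obtain ⟨g₁, hLg₁⟩ := edgeLike_eq_map_branchSubgroup c𝒢 hv₁ (q₁ ▸ hL) (ψ v₁) (hψ v₁)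
  obtain ⟨g₂, hLg₂⟩ := edgeLike_eq_map_branchSubgroup c𝒢 hv₂ (q₂ ▸ hL) (ψ v₂) (hψ v₂)
  -- the source hosts and the identification `{K₁, H₁} = {V₁, V₂}`
  set V₁ := (ψ v₁).toMonoidHom.range.map (MulAut.conj g₁).toMonoidHom with hV₁def
  set V₂ := (ψ v₂).toMonoidHom.range.map (MulAut.conj g₂).toMonoidHom with hV₂def
  have hV₁ : V₁ ∈ verticialSubgroups c𝒢 v₁ :=
    conj_mem_verticialSubgroups c𝒢 (range_mem_verticialSubgroups c𝒢 (ψ v₁) (hψ v₁)) g₁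
  have hV₂ : V₂ ∈ verticialSubgroups c𝒢 v₂ :=
    conj_mem_verticialSubgroups c𝒢 (range_mem_verticialSubgroups c𝒢 (ψ v₂) (hψ v₂)) g₂
  have hLV₁ : K₁ ⊓ H₁ ≤ V₁ := by rw [hLg₁]; exact Subgroup.map_mono (Subgroup.map_le_range _ _)
  have hLV₂ : K₁ ⊓ H₁ ≤ V₂ := by rw [hLg₂]; exact Subgroup.map_mono (Subgroup.map_le_range _ _)
  have hVne : V₁ ≠ V₂ := fun hEq =>
    hb12 (branch_eq_of_hosts_eq h37ii h37i h𝒢37 c𝒢 ψ hψ hnt hv₁ hv₂ g₁ g₂ hLg₁.le hLg₂.le hEq)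
  have hLc : IsCompact ((K₁ ⊓ H₁ : Subgroup c𝒢.G) : Set c𝒢.G) := by
    rw [Subgroup.coe_inf]; exact hK₁.1.inter_right hH₁.1.isClosed
  obtain ⟨honly, -⟩ := (h37iii h𝒢37 c𝒢 _ hLc).2 hnt v₁ v₂ V₁ V₂ hV₁ hV₂ hVne hLV₁ hLV₂
  obtain ⟨u₁, hK₁u⟩ := (hmax𝒢 K₁).mp hK₁
  obtain ⟨u₂, hH₁u⟩ := (hmax𝒢 H₁).mp hH₁
  -- the target hosts `Tᵢ = mᵢ Ψ_{F vᵢ}(Π) mᵢ⁻¹` through the branches `F bᵢ`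
  have htarget : ∀ {b : 𝒢.graph.Branch} {v : 𝒢.graph.Vertex} (hv : 𝒢.graph.abuts b = some v)
      (q : 𝒢.graph.edgeOf b = e) (g : c𝒢.G),
      K₁ ⊓ H₁ = ((𝒢.branchSubgroup b v hv).map (ψ v).toMonoidHom).map (MulAut.conj g).toMonoidHom →
      ∃ m : cℋ.G,
        ((ψ v).toMonoidHom.range.map (MulAut.conj g).toMonoidHom).map φ.toMonoidHom ≤
          (Ψ (F.base.vertexMap v)).toMonoidHom.range.map (MulAut.conj m).toMonoidHom ∧
        (K₁ ⊓ H₁).map φ.toMonoidHom ≤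
          ((ℋ.branchSubgroup (F.base.branchMap b) (F.base.vertexMap v)
            (F.base.abuts_branchMap b v hv)).map (Ψ (F.base.vertexMap v)).toMonoidHom).map
            (MulAut.conj m).toMonoidHom ∧
        (K₁ ⊓ H₁).map φ.toMonoidHom ≠ ⊥ := by
    intro b v hv q g hLg
    subst q
    obtain ⟨c, hc⟩ := hV v (ψ v) (Ψ (F.base.vertexMap v)) (hψ v) (hΨ _)
    obtain ⟨γ, hγ⟩ := F.exists_conj b v hv (F.base.edgeMap (𝒢.graph.edgeOf b)) rfl
      (F.base.edgeOf_branchMap b)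
    have hγz : ∀ z, γ * ℋ.brHomAt (F.base.branchMap b) (F.base.vertexMap v)
        (F.base.abuts_branchMap b v hv) _ (F.base.edgeOf_branchMap b) (F.hE _ z) * γ⁻¹ =
        F.hV v (𝒢.brHom b v hv z) := fun z => by
      have h := hγ z
      rw [Hom.hEAt_rfl] at h
      exact h
    refine ⟨φ g * c * Ψ (F.base.vertexMap v) γ, ?_, ?_, ?_⟩
    · rintro _ ⟨_, ⟨_, ⟨y, rfl⟩, rfl⟩, rfl⟩
      refine ⟨Ψ _ (γ⁻¹ * F.hV v y * γ), ⟨γ⁻¹ * F.hV v y * γ, rfl⟩, ?_⟩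
      show φ g * c * Ψ (F.base.vertexMap v) γ * Ψ _ (γ⁻¹ * F.hV v y * γ) *
          (φ g * c * Ψ (F.base.vertexMap v) γ)⁻¹ = φ (g * ψ v y * g⁻¹)
      rw [map_mul φ, map_mul φ, map_inv φ, hc y, map_mul (Ψ _), map_mul (Ψ _), map_inv (Ψ _)]
      group
    · rw [hLg]
      rintro _ ⟨_, ⟨_, ⟨_, ⟨z, rfl⟩, rfl⟩, rfl⟩, rfl⟩
      refine ⟨Ψ _ (ℋ.brHomAt (F.base.branchMap b) (F.base.vertexMap v) (F.base.abuts_branchMap b v hv)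
          _ (F.base.edgeOf_branchMap b) (F.hE _ z)), ⟨_, brHomAt_mem_branchSubgroup _ _ _, rfl⟩, ?_⟩
      show φ g * c * Ψ (F.base.vertexMap v) γ * Ψ _ (ℋ.brHomAt (F.base.branchMap b)
          (F.base.vertexMap v) (F.base.abuts_branchMap b v hv) _ (F.base.edgeOf_branchMap b)
          (F.hE _ z)) * (φ g * c * Ψ (F.base.vertexMap v) γ)⁻¹ =
          φ (g * ψ v (𝒢.brHom b v hv z) * g⁻¹)
      rw [map_mul φ, map_mul φ, map_inv φ, hc, ← hγz z, map_mul (Ψ _), map_mul (Ψ _), map_inv (Ψ _)]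
      group
    · -- nontriviality: `F` is locally open, `Π_{F e}` is infinite
      intro h0
      have hopen := hF.2 (𝒢.graph.edgeOf b)
      -- transport along `edgeOf (F b) = F (edgeOf b)` to apply `ne_bot_of_isOpen_ge`
      have key : ∀ (f : ℋ.graph.Edge) (qq : ℋ.graph.edgeOf (F.base.branchMap b) = f)
          (η : 𝒢.Ge (𝒢.graph.edgeOf b) →ₜ* ℋ.Ge f), IsOpen (η.toMonoidHom.range : Set (ℋ.Ge f)) →
          (∀ z, φ (g * ψ v (𝒢.brHom b v hv z) * g⁻¹) =
            (φ g * c * Ψ _ γ) * Ψ _ (ℋ.brHomAt (F.base.branchMap b) (F.base.vertexMap v)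
              (F.base.abuts_branchMap b v hv) f qq (η z)) * (φ g * c * Ψ _ γ)⁻¹) → False := by
        intro f qq η hη hφ
        subst qq
        apply ne_bot_of_isOpen_ge hℋ37.toProp36Hypotheses (F.base.abuts_branchMap b v hv) hη
        rw [eq_bot_iff]
        rintro _ ⟨z, rfl⟩
        have hz : φ (g * ψ v (𝒢.brHom b v hv z) * g⁻¹) ∈ (K₁ ⊓ H₁).map φ.toMonoidHom :=
          ⟨_, hLg ▸ ⟨_, ⟨_, ⟨z, rfl⟩, rfl⟩, rfl⟩, rfl⟩
        rw [h0, Subgroup.mem_bot, hφ z] at hz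
        have h1 : Ψ _ (ℋ.brHomAt (F.base.branchMap b) (F.base.vertexMap v)
            (F.base.abuts_branchMap b v hv) _ rfl (η z)) = 1 := by
          have := hz; rw [mul_inv_eq_one, mul_eq_left] at this; exact this
        have h2 := (h37i ℋ hℋ37 cℋ _).2 (Ψ _) (hΨ _) (by rw [h1, map_one] : Ψ _ _ = Ψ _ 1)
        have h3 := brHomAt_injective hℋ.isOfInjectiveType (F.base.abuts_branchMap b v hv) rfl
          (by rw [h2, map_one] : ℋ.brHomAt _ _ _ _ rfl (η z) = ℋ.brHomAt _ _ _ _ rfl 1)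
        exact h3
      refine key _ (F.base.edgeOf_branchMap b) (F.hE _) hopen fun z => ?_
      rw [map_mul φ, map_mul φ, map_inv φ, hc, ← hγz z, map_mul (Ψ _), map_mul (Ψ _), map_inv (Ψ _)]
      group
  obtain ⟨m₁, hT₁, hLT₁, hLne⟩ := htarget hv₁ q₁ g₁ hLg₁
  obtain ⟨m₂, hT₂, hLT₂, -⟩ := htarget hv₂ q₂ g₂ hLg₂
  -- the target hosts are distinct
  have hTne : (Ψ (F.base.vertexMap v₁)).toMonoidHom.range.map (MulAut.conj m₁).toMonoidHom ≠
      (Ψ (F.base.vertexMap v₂)).toMonoidHom.range.map (MulAut.conj m₂).toMonoidHom := fun hEq =>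
    hb12 (F.base.branchMap_injOn b₁ b₂ (q₁.trans q₂.symm)
      (branch_eq_of_hosts_eq h37ii h37i hℋ37 cℋ Ψ hΨ hLne (F.base.abuts_branchMap b₁ v₁ hv₁)
        (F.base.abuts_branchMap b₂ v₂ hv₂) m₁ m₂ hLT₁ hLT₂ hEq))
  have hT₁m : (Ψ (F.base.vertexMap v₁)).toMonoidHom.range.map (MulAut.conj m₁).toMonoidHom ∈
      verticialSubgroups cℋ (F.base.vertexMap v₁) :=
    conj_mem_verticialSubgroups cℋ (range_mem_verticialSubgroups cℋ (Ψ _) (hΨ _)) m₁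
  have hT₂m : (Ψ (F.base.vertexMap v₂)).toMonoidHom.range.map (MulAut.conj m₂).toMonoidHom ∈
      verticialSubgroups cℋ (F.base.vertexMap v₂) :=
    conj_mem_verticialSubgroups cℋ (range_mem_verticialSubgroups cℋ (Ψ _) (hΨ _)) m₂
  -- `K₁`, `H₁` are `V₁`, `V₂` in some order
  rcases honly u₁ K₁ hK₁u inf_le_left with hK1 | hK2 <;>
    rcases honly u₂ H₁ hH₁u inf_le_right with hH1 | hH2
  · exact absurd (hK1.trans hH1.symm) hne
  · exact ⟨_, _, (hmaxℋ _).mpr ⟨_, hT₁m⟩, (hmaxℋ _).mpr ⟨_, hT₂m⟩, hTne, hK1 ▸ hT₁, hH2 ▸ hT₂⟩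
  · exact ⟨_, _, (hmaxℋ _).mpr ⟨_, hT₂m⟩, (hmaxℋ _).mpr ⟨_, hT₁m⟩, hTne.symm, hK2 ▸ hT₂, hH1 ▸ hT₁⟩
  · exact absurd (hK2.trans hH2.symm) hne

/-- **Cor. 3.9 (a) under the compatible reading of Def. 3.8, AT the pair `(𝒢, ℋ)`** (φ2 twin of
`isCompatiblyQuasiGeometric_of_compat`): a homomorphism compatible with a locally open morphism of
semi-graphs of anabelioids on verticial and edge homomorphisms is COMPATIBLY quasi-geometric
(`IsCompatiblyQuasiGeometric`), from Thm 3.7 (i), (ii), Thm 3.7 (iii) at `𝒢` and Thm 3.7 (iv) at `𝒢`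
and at `ℋ` (the literal half is abc-iut-L3-d1's `InducedIsQuasiGeometric_of_at`).
[cite: MochizukiSemiAnbd2006, Cor 3.9 p.42] -/
theorem isCompatiblyQuasiGeometric_of_compatAt (h37i : VerticialInjective.{u})
    (h37ii : VerticialDistinct.{u}) (h37iii : CompactInVerticialAt 𝒢)
    (h37iv𝒢 : MaximalCompactIffVerticialAt 𝒢) (h37ivℋ : MaximalCompactIffVerticialAt ℋ)
    (h𝒢 : Cor39Hypotheses 𝒢) (hℋ : Cor39Hypotheses ℋ)
    (c𝒢 : TemperedPiChart 𝒢) (cℋ : TemperedPiChart ℋ) (F : Hom 𝒢 ℋ) (φ : c𝒢.G →ₜ* cℋ.G)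
    (hF : F.IsLocallyOpen) (hV : F.CompatV c𝒢 cℋ φ) (hE : F.CompatE c𝒢 cℋ φ) :
    IsCompatiblyQuasiGeometric φ :=
  ⟨InducedIsQuasiGeometric_of_at h37i h37iv𝒢 h37ivℋ h𝒢 hℋ c𝒢 cℋ F φ hF hV hE,
    compat_of_compatVAt h37i h37ii h37iii h37iv𝒢 h37ivℋ h𝒢 hℋ c𝒢 cℋ F φ hF hV⟩

end ProfiniteSemiGraph

end Literature.AnabelianGeometry.SemiGraphs
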